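import Literature.AlgebraicGeometry.Modules.RankOneEndomorphismScalar
import Literature.AlgebraicGeometry.Modules.LineBundleOfCocycleClass
import HarnessLib

/-!
# Normalised isomorphisms of rank-one modules rigidified along a section (any Stein family)

Layer `Literature/AlgebraicGeometry/Modules`, namespace `Literature.AlgebraicGeometry.Modules`.
THEOREMS ONLY (no definition, no named fact, no instance).

[MumfordAV1970, §13, proof of the Theorem p. 125] «an isomorphism of line bundles rigidified along the zero section can
be normalised, and normalised isomorphisms are unique because `p_*𝒪 = 𝒪`»; [BoschLutkebohmertRaynaud1990, §8.1
Prop. 4]; [MumfordFogartyKirwan1994, Ch. 6 §2 (p. 121)].  GENERIC SCHEME-LEVEL form: a morphism `p : X ⟶ T` with a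
SECTION `e : T ⟶ X` (`e ≫ p = 𝟙`; think `X = A ×_S T → T` with the unit section), rank-one `𝒪_X`-modules `E₁ E₂` with
CHOSEN rigidifications `rₖ : e^*Eₖ ≅ 𝒪_T`; an isomorphism `φ : E₁ ≅ E₂` is NORMALISED if `e^*φ ≫ r₂ = r₁`.  The only input
about `p` is «Stein on global functions»: `p^♯ : Γ(T, 𝒪) → Γ(X, 𝒪)` SURJECTIVE (for `A_T → T`, `T` any scheme over a
locally Noetherian `S`: ★ `AbelianSchemes.AbelianSchemeSteinOfNoetherian.baseChange_appTop_bijective`).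

* §1 `appTop_eq_appTop_section_appTop` — a global function on `X` is `p^♯` of its restriction along `e`;
* §2 `hom_eq_id_of_pullback_section_map_eq_id`, `iso_eq_of_pullback_section_map_eq`, `iso_eq_of_normalised` —
  UNIQUENESS: a rigidified automorphism of a rank-one module is `𝟙` (★ `exists_unique_eq_globalScalar`, ★
  `pullback_map_globalScalar`, ★ `eq_of_globalScalar_eq`); normalised isomorphisms are unique;
* §3 `exists_iso_normalised` (any `p`, no Stein), `existsUnique_iso_normalised`, `iso_trans_eq_of_normalised` — EXISTENCE
  by rescaling with `p^♯` of the defect unit, and the COCYCLE IDENTITY for free;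
* §4 `pullback_map_normalised` — STABILITY UNDER BASE CHANGE (the «nub» of Zariski glueing of rigidified families): for
  a commutative square of sections `e' ≫ g = t ≫ e` (`g : X' ⟶ X`, `t : T' ⟶ T`, `e' : T' ⟶ X'`), `g^*φ` is normalised for
  the TRANSPORTED rigidifications `e'^*g^*Eₖ ≅ (e' ≫ g)^*Eₖ ≅ (t ≫ e)^*Eₖ ≅ t^*e^*Eₖ ≅ t^*𝒪_T ≅ 𝒪_{T'}` (Mathlib
  `Scheme.Modules.pullbackComp` / `pullbackCongr`, any identification `υ : t^*𝒪_T ≅ 𝒪_{T'}`) — by NATURALITY of these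
  identifications, no coherence needed.

This generalises the HOME seed `AbelianSchemes/RigidifiedIsoNormalize` (B-p06 (g14), stated for `A.baseChange f`) to any
Stein `p` with a section; it is file 1 of the (Z1-sec) programme «the rigidified rank-one functor is a Zariski sheaf on
the base» (cell hodgecm-mathlib, FLOOR 0 P1, F-3 (Z)).  Everything is proved; no named facts.

## References
* [MumfordAV1970] D. Mumford, *Abelian Varieties* (1970), §13 (proof of the Thm. p. 125), §5 Cor. 6 (p. 54).
* [BoschLutkebohmertRaynaud1990] S. Bosch, W. Lütkebohmert, M. Raynaud, *Néron Models* (1990), §8.1 Prop. 4.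
* [MumfordFogartyKirwan1994] D. Mumford, J. Fogarty, F. Kirwan, *GIT*, 3rd ed. (1994), Ch. 6 §2 (p. 121).
* [MilneAV2008] J. S. Milne, *Abelian Varieties* (v2.00, 2008), I §8 pp. 36–37.
-/

noncomputable section

-- `Scheme.Modules` / `SheafOfModules` are not reducible (as in Mathlib's `AlgebraicGeometry/Modules/Sheaf.lean`).
set_option backward.isDefEq.respectTransparency false

open CategoryTheory AlgebraicGeometry Opposite TopologicalSpace

universe u

namespace Literature.AlgebraicGeometry.Modules

open Literature.AlgebraicGeometry.Motives

variable {X T : Scheme.{u}} (p : X ⟶ T) (e : T ⟶ X) (he : e ≫ p = 𝟙 T)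

/-! ### §1 Global functions are read along the section -/

include he in
/-- `e^♯ (p^♯ c) = c` for a section `e` of `p`. [cite: MumfordFogartyKirwan1994, Ch. 6 §1 Definition 6.1 (p. 115)] -/
theorem section_appTop_appTop (c : Γ(T, ⊤)) : e.appTop (p.appTop c) = c := by
  rw [← CommRingCat.comp_apply p.appTop, ← Scheme.Hom.comp_appTop, he, Scheme.Hom.id_appTop]
  rfl

include he in
/-- **A global function on `X` is `p^♯` of its restriction along the section** when `p^♯` is surjective on global
functions (Stein). [cite: MumfordAV1970, §5 Cor. 6 (p. 54)] -/
theorem appTop_eq_appTop_section_appTop (hp : Function.Surjective p.appTop) (a : Γ(X, ⊤)) :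
    a = p.appTop (e.appTop a) := by
  obtain ⟨c, rfl⟩ := hp a
  rw [section_appTop_appTop p e he]

/-! ### §2 Uniqueness: rigidified automorphisms of rank-one modules are trivial -/

include he in
/-- **An endomorphism of a rank-one module on `X` whose restriction along the section `e` is the identity IS the
identity** (`p^♯` surjective on global functions): `α = a · 𝟙` for a global function `a` (★ `exists_unique_eq_globalScalar`),
`e^*α = e^♯(a) · 𝟙 = 𝟙` forces `e^♯ a = 1` (★ `pullback_map_globalScalar`, ★ `eq_of_globalScalar_eq`), hence `a = p^♯ 1 = 1`.
[cite: MumfordAV1970, §13 (p. 125)] -/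
theorem hom_eq_id_of_pullback_section_map_eq_id (hp : Function.Surjective p.appTop) {E : X.Modules}
    (h₁ : HasRank E 1) (α : E ⟶ E) (h : (Scheme.Modules.pullback e).map α = 𝟙 _) : α = 𝟙 E := by
  obtain ⟨a, ha, -⟩ := exists_unique_eq_globalScalar h₁ α
  rw [ha] at h ⊢
  rw [pullback_map_globalScalar, ← globalScalar_one] at h
  have ha1 : e.appTop a = 1 := eq_of_globalScalar_eq Nat.one_pos (hasRank_pullback _ h₁) h
  rw [appTop_eq_appTop_section_appTop p e he hp a, ha1, map_one, globalScalar_one]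

include he in
/-- **Two morphisms of rank-one modules `E → E'`, the second an isomorphism, with the same restriction along the section
are equal.** [cite: MumfordAV1970, §13 (p. 125)] -/
theorem hom_eq_of_pullback_section_map_eq (hp : Function.Surjective p.appTop) {E E' : X.Modules} (h₁ : HasRank E 1)
    (α β : E ⟶ E') [IsIso β]
    (h : (Scheme.Modules.pullback e).map α = (Scheme.Modules.pullback e).map β) : α = β := by
  have hid : α ≫ inv β = 𝟙 E := by
    refine hom_eq_id_of_pullback_section_map_eq_id p e he hp h₁ (α ≫ inv β) ?_
    rw [Functor.map_comp, h, ← Functor.map_comp, IsIso.hom_inv_id]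
    exact (Scheme.Modules.pullback e).map_id E
  simpa only [Category.assoc, IsIso.inv_hom_id, Category.comp_id, Category.id_comp] using congrArg (· ≫ β) hid

include he in
/-- **Rigidified isomorphisms of rank-one modules are unique**: two isomorphisms `E ≅ E'` with the same restriction along
the section coincide. [cite: MumfordAV1970, §13 (p. 125)] [cite: MilneAV2008, I §8 pp. 36–37] -/
theorem iso_eq_of_pullback_section_map_eq (hp : Function.Surjective p.appTop) {E E' : X.Modules} (h₁ : HasRank E 1)
    (α β : E ≅ E')
    (h : (Scheme.Modules.pullback e).map α.hom = (Scheme.Modules.pullback e).map β.hom) : α = β :=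
  Iso.ext (hom_eq_of_pullback_section_map_eq p e he hp h₁ α.hom β.hom h)

include he in
/-- **NORMALISED ISOMORPHISMS ARE UNIQUE**: for chosen rigidifications `rₖ : e^*Eₖ ≅ 𝒪_T`, two isomorphisms
`φ ψ : E₁ ≅ E₂` with `e^*φ ≫ r₂ = r₁ = e^*ψ ≫ r₂` coincide. [cite: MumfordAV1970, §13 (p. 125)]
[cite: BoschLutkebohmertRaynaud1990, §8.1 Prop. 4] -/
theorem iso_eq_of_normalised (hp : Function.Surjective p.appTop) {E₁ E₂ : X.Modules} (h₁ : HasRank E₁ 1)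
    (r₁ : (Scheme.Modules.pullback e).obj E₁ ≅ SheafOfModules.unit _)
    (r₂ : (Scheme.Modules.pullback e).obj E₂ ≅ SheafOfModules.unit _) (φ ψ : E₁ ≅ E₂)
    (nφ : (Scheme.Modules.pullback e).map φ.hom ≫ r₂.hom = r₁.hom)
    (nψ : (Scheme.Modules.pullback e).map ψ.hom ≫ r₂.hom = r₁.hom) : φ = ψ := by
  refine iso_eq_of_pullback_section_map_eq p e he hp h₁ φ ψ ?_
  rw [← cancel_mono r₂.hom, nφ, nψ]

/-! ### §3 Existence of normalised isomorphisms; the cocycle identity for free -/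

/-- `𝒪_X` has rank one (frame `𝒪^{PUnit} ≅ 𝒪|_⊤`, ★ `freePUnitIso`). [cite: Hartshorne1977, II.5 (p. 109)] -/
private theorem hasRank_unit_one' {Y : Scheme.{u}} : HasRank (SheafOfModules.unit Y.ringCatSheaf : Y.Modules) 1 :=
  FrameSystem.hasRank (E := (SheafOfModules.unit Y.ringCatSheaf : Y.Modules))
    { U := fun _ => ⊤, mem := fun _ => trivial, I := fun _ => PUnit, rank := fun _ => 1,
      enum := fun _ => Equiv.ofUnique PUnit (Fin 1), frame := fun _ => freePUnitIso ⊤ } 1 fun _ => rfl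

/-- **NORMALISATION of an isomorphism of rigidified rank-one modules** (any `p` with a section, no Stein hypothesis):
given rigidifications `rₖ : e^*Eₖ ≅ 𝒪_T` and ANY isomorphism `α : E₁ ≅ E₂`, there is `φ : E₁ ≅ E₂` with `e^*φ ≫ r₂ = r₁`:
the defect `r₁⁻¹ ≫ e^*α ≫ r₂` is multiplication by a unit `d ∈ Γ(T, 𝒪_T)` (★ `exists_unique_eq_globalScalar` on `𝒪_T`),
and `φ := α ≫ (p^♯ d⁻¹ · )` works because `e^*(p^♯ c · ) = c ·` (★ `pullback_map_globalScalar`, `e ≫ p = 𝟙`).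
[cite: MumfordAV1970, §13 (p. 125)] [cite: MilneAV2008, I §8 pp. 36–37] -/
theorem exists_iso_normalised (p : X ⟶ T) (e : T ⟶ X) (he : e ≫ p = 𝟙 T) {E₁ E₂ : X.Modules}
    (r₁ : (Scheme.Modules.pullback e).obj E₁ ≅ SheafOfModules.unit _)
    (r₂ : (Scheme.Modules.pullback e).obj E₂ ≅ SheafOfModules.unit _) (α : E₁ ≅ E₂) :
    ∃ φ : E₁ ≅ E₂, (Scheme.Modules.pullback e).map φ.hom ≫ r₂.hom = r₁.hom := by
  have hO : HasRank (SheafOfModules.unit T.ringCatSheaf : T.Modules) 1 := hasRank_unit_one'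
  -- the defect of `α` along the section: an automorphism of `𝒪_T`, i.e. a unit `d` of `Γ(T, 𝒪_T)`
  let δ : (SheafOfModules.unit T.ringCatSheaf : T.Modules) ≅ SheafOfModules.unit _ :=
    r₁.symm ≪≫ (Scheme.Modules.pullback e).mapIso α ≪≫ r₂
  obtain ⟨d, hd, -⟩ := exists_unique_eq_globalScalar hO δ.hom
  obtain ⟨d', hd', -⟩ := exists_unique_eq_globalScalar hO δ.inv
  have hdd' : d * d' = 1 := by
    refine eq_of_globalScalar_eq Nat.one_pos hO ?_
    rw [globalScalar_mul, ← hd, ← hd', globalScalar_one]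
    exact δ.inv_hom_id
  have hd'd : d' * d = 1 := by rw [mul_comm]; exact hdd'
  -- rescale `α` by `p^♯ d'` on `E₂`
  let eD : E₂ ≅ E₂ :=
    { hom := globalScalar E₂ (p.appTop d')
      inv := globalScalar E₂ (p.appTop d)
      hom_inv_id := by rw [← globalScalar_mul, ← map_mul, hdd', map_one, globalScalar_one]
      inv_hom_id := by rw [← globalScalar_mul, ← map_mul, hd'd, map_one, globalScalar_one] }
  have heD : eD.hom = globalScalar E₂ (p.appTop d') := rfl
  have hα : (Scheme.Modules.pullback e).map α.hom ≫ r₂.hom = r₁.hom ≫ δ.hom := by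
    simp only [δ, Iso.trans_hom, Iso.symm_hom, Functor.mapIso_hom, Iso.hom_inv_id_assoc]
  refine ⟨α ≪≫ eD, ?_⟩
  rw [Iso.trans_hom, Functor.map_comp, Category.assoc, heD, pullback_map_globalScalar e E₂ (p.appTop d'),
    section_appTop_appTop p e he, globalScalar_comp r₂.hom d', ← Category.assoc, hα, Category.assoc, hd,
    ← globalScalar_mul, hd'd, globalScalar_one, Category.comp_id]

include he in
/-- **NORMALISED ISOMORPHISMS OF RIGIDIFIED RANK-ONE MODULES EXIST UNIQUELY** (`p^♯` surjective on global functions):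
if `E₁ ≅ E₂` at all then there is a unique `φ : E₁ ≅ E₂` with `e^*φ ≫ r₂ = r₁` — the rigidified Picard functor is
separated for the Zariski topology by exactly this statement. [cite: MumfordAV1970, §13 (p. 125)]
[cite: BoschLutkebohmertRaynaud1990, §8.1 Prop. 4] -/
theorem existsUnique_iso_normalised (hp : Function.Surjective p.appTop) {E₁ E₂ : X.Modules} (h₁ : HasRank E₁ 1)
    (r₁ : (Scheme.Modules.pullback e).obj E₁ ≅ SheafOfModules.unit _)
    (r₂ : (Scheme.Modules.pullback e).obj E₂ ≅ SheafOfModules.unit _) (hα : Nonempty (E₁ ≅ E₂)) :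
    ∃! φ : E₁ ≅ E₂, (Scheme.Modules.pullback e).map φ.hom ≫ r₂.hom = r₁.hom := by
  obtain ⟨φ, hφ⟩ := exists_iso_normalised p e he r₁ r₂ hα.some
  exact ⟨φ, hφ, fun ψ hψ => iso_eq_of_normalised p e he hp h₁ r₁ r₂ ψ φ hψ hφ⟩

include he in
/-- **Normalised isomorphisms satisfy the COCYCLE IDENTITY for free**: normalised `φ₁₂`, `φ₂₃`, `φ₁₃` between three
rigidified rank-one modules satisfy `φ₁₂ ≫ φ₂₃ = φ₁₃` (both sides are normalised isomorphisms `E₁ ≅ E₃`).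
[cite: MumfordAV1970, §13 (p. 125)] [cite: BoschLutkebohmertRaynaud1990, §8.1 Prop. 4] -/
theorem iso_trans_eq_of_normalised (hp : Function.Surjective p.appTop) {E₁ E₂ E₃ : X.Modules} (h₁ : HasRank E₁ 1)
    (r₁ : (Scheme.Modules.pullback e).obj E₁ ≅ SheafOfModules.unit _)
    (r₂ : (Scheme.Modules.pullback e).obj E₂ ≅ SheafOfModules.unit _)
    (r₃ : (Scheme.Modules.pullback e).obj E₃ ≅ SheafOfModules.unit _)
    (φ₁₂ : E₁ ≅ E₂) (φ₂₃ : E₂ ≅ E₃) (φ₁₃ : E₁ ≅ E₃)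
    (n₁₂ : (Scheme.Modules.pullback e).map φ₁₂.hom ≫ r₂.hom = r₁.hom)
    (n₂₃ : (Scheme.Modules.pullback e).map φ₂₃.hom ≫ r₃.hom = r₂.hom)
    (n₁₃ : (Scheme.Modules.pullback e).map φ₁₃.hom ≫ r₃.hom = r₁.hom) : φ₁₂ ≪≫ φ₂₃ = φ₁₃ := by
  refine iso_eq_of_normalised p e he hp h₁ r₁ r₃ _ _ ?_ n₁₃
  rw [Iso.trans_hom, Functor.map_comp, Category.assoc, n₂₃, n₁₂]

/-! ### §4 Stability of normalised isomorphisms under base change (the nub of Zariski glueing) -/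

section BaseChange

variable {X' T' : Scheme.{u}} (g : X' ⟶ X) (t : T' ⟶ T) (e' : T' ⟶ X') (hsq : e' ≫ g = t ≫ e)
  (υ : (Scheme.Modules.pullback t).obj (SheafOfModules.unit T.ringCatSheaf) ≅ SheafOfModules.unit T'.ringCatSheaf)

/-- **STABILITY OF NORMALISED ISOMORPHISMS UNDER BASE CHANGE.**  For a commutative square of sections `e' ≫ g = t ≫ e`
(`g : X' ⟶ X` over `t : T' ⟶ T`, `e'` a section of `X' → T'` — e.g. `1_A × t : A_{T'} → A_T` and the unit sections) and
an isomorphism `φ : E₁ ≅ E₂` NORMALISED for `rₖ : e^*Eₖ ≅ 𝒪_T`, the pull-back `g^*φ` is normalised for the TRANSPORTED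
rigidifications `e'^*g^*Eₖ ≅ (e' ≫ g)^*Eₖ ≅ (t ≫ e)^*Eₖ ≅ t^*e^*Eₖ ≅ t^*𝒪_T ≅ 𝒪_{T'}` (Mathlib `Scheme.Modules.pullbackComp`,
`pullbackCongr`, and ANY identification `υ : t^*𝒪_T ≅ 𝒪_{T'}`, the same for `k = 1, 2`).  Proof: naturality of the three
identifications in `Eₖ`, then functoriality of `t^*` — no coherence between `pullbackComp`'s is needed.
[cite: BoschLutkebohmertRaynaud1990, §8.1 Prop. 4] [cite: MumfordAV1970, §13 (p. 125)] -/
theorem pullback_map_normalised {E₁ E₂ : X.Modules}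
    (r₁ : (Scheme.Modules.pullback e).obj E₁ ≅ SheafOfModules.unit _)
    (r₂ : (Scheme.Modules.pullback e).obj E₂ ≅ SheafOfModules.unit _) (φ : E₁ ≅ E₂)
    (n : (Scheme.Modules.pullback e).map φ.hom ≫ r₂.hom = r₁.hom) :
    (Scheme.Modules.pullback e').map ((Scheme.Modules.pullback g).map φ.hom) ≫
        ((Scheme.Modules.pullbackComp e' g).app E₂ ≪≫ (Scheme.Modules.pullbackCongr hsq).app E₂ ≪≫
          ((Scheme.Modules.pullbackComp t e).app E₂).symm ≪≫ (Scheme.Modules.pullback t).mapIso r₂ ≪≫ υ).hom =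
      ((Scheme.Modules.pullbackComp e' g).app E₁ ≪≫ (Scheme.Modules.pullbackCongr hsq).app E₁ ≪≫
          ((Scheme.Modules.pullbackComp t e).app E₁).symm ≪≫ (Scheme.Modules.pullback t).mapIso r₁ ≪≫ υ).hom := by
  have h₁ := (Scheme.Modules.pullbackComp e' g).hom.naturality φ.hom
  have h₂ := (Scheme.Modules.pullbackCongr hsq).hom.naturality φ.hom
  have h₃ := (Scheme.Modules.pullbackComp t e).inv.naturality φ.hom
  simp only [Iso.trans_hom, Iso.app_hom, Iso.symm_hom, Iso.app_inv, Functor.mapIso_hom, Functor.comp_map] at h₁ h₂ h₃ ⊢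
  rw [← Category.assoc, h₁, Category.assoc, ← Category.assoc ((Scheme.Modules.pullback (e' ≫ g)).map φ.hom), h₂,
    Category.assoc, ← Category.assoc ((Scheme.Modules.pullback (t ≫ e)).map φ.hom), h₃, Category.assoc,
    ← Category.assoc ((Scheme.Modules.pullback t).map ((Scheme.Modules.pullback e).map φ.hom)), ← Functor.map_comp, n]

/-- **Base change of THE normalised isomorphism is THE normalised isomorphism**: with `p' : X' ⟶ T'` Stein with section
`e'` and the square `e' ≫ g = t ≫ e`, if `φ` is the normalised isomorphism on `X` (for `r₁, r₂`) and `φ'` is ANY normalised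
isomorphism on `X'` for the transported rigidifications, then `φ' = g^*φ`.
[cite: BoschLutkebohmertRaynaud1990, §8.1 Prop. 4] [cite: MumfordAV1970, §13 (p. 125)] -/
theorem eq_pullback_mapIso_of_normalised (p' : X' ⟶ T') (he' : e' ≫ p' = 𝟙 T') (hp' : Function.Surjective p'.appTop)
    {E₁ E₂ : X.Modules} (h₁ : HasRank E₁ 1)
    (r₁ : (Scheme.Modules.pullback e).obj E₁ ≅ SheafOfModules.unit _)
    (r₂ : (Scheme.Modules.pullback e).obj E₂ ≅ SheafOfModules.unit _) (φ : E₁ ≅ E₂)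
    (n : (Scheme.Modules.pullback e).map φ.hom ≫ r₂.hom = r₁.hom)
    (φ' : (Scheme.Modules.pullback g).obj E₁ ≅ (Scheme.Modules.pullback g).obj E₂)
    (n' : (Scheme.Modules.pullback e').map φ'.hom ≫
        ((Scheme.Modules.pullbackComp e' g).app E₂ ≪≫ (Scheme.Modules.pullbackCongr hsq).app E₂ ≪≫
          ((Scheme.Modules.pullbackComp t e).app E₂).symm ≪≫ (Scheme.Modules.pullback t).mapIso r₂ ≪≫ υ).hom =
      ((Scheme.Modules.pullbackComp e' g).app E₁ ≪≫ (Scheme.Modules.pullbackCongr hsq).app E₁ ≪≫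
          ((Scheme.Modules.pullbackComp t e).app E₁).symm ≪≫ (Scheme.Modules.pullback t).mapIso r₁ ≪≫ υ).hom) :
    φ' = (Scheme.Modules.pullback g).mapIso φ :=
  iso_eq_of_normalised p' e' he' hp' (hasRank_pullback g h₁) _ _ φ' _ n'
    (pullback_map_normalised e g t e' hsq υ r₁ r₂ φ n)

end BaseChange

end Literature.AlgebraicGeometry.Modules

end
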